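import Summits.QuantumAdvantage.QuantumAdvantage.Theorems.CouplingDialThreshold

/-!
# CouplingDial (part C, hidden coupling) — ★ `U_0` IS A THEOREM: exact quadratic Forrelation through a hidden invertible coupling ∉ promise-`AC⁰[⊕]`

Tree twin of node «CouplingDial» rev 2 §9 (cut verbatim).  THE TRANSPOSE PLANTING `hinst w = ⟨6m+6, F_w, Gsw_w, Q_w ⊕ Q_wᵀ⟩`: summing the first
half forces `x″ = y′ ⊕ Q_w⁻¹e_{a₀}` and the transpose identity `⟨q, Q_wᵀy″⟩ = ⟨Q_w q, y″⟩` cancels everything but `(Q_w⁻¹e_{a₀})_{b₀} = [#₁w ≡ 0 (3)]`: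
`cvalue_hinst`, `kerCard_hinst`, `isProj_encode_hinst`, `hiddenCouplingRung : HiddenCouplingRung`, `couplingRung_all : ∀ d, CouplingRung d`,
`couplingLift_iff_rungANonuniform : CouplingLift ↔ RungANonuniform`, `closes'`.  The co-rank dial is thereby DECIDED below `RungANonuniform`.
-/

set_option linter.dupNamespace false

noncomputable section

namespace Summit.QuantumAdvantage.QuantumAdvantage.Theorems.CouplingDial

open Finset
open Literature.Computability.Complexity
open Literature.Computability.QuantumComplexity
open Literature.Computability.MetaComplexity
open _root_.Computability (encodeNat)
open Summit.QuantumAdvantage.QuantumAdvantage.Theorems.HintDial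
open Summit.QuantumAdvantage.QuantumAdvantage.Theorems.HintDial.Automaton
open Summit.QuantumAdvantage.QuantumAdvantage.Theorems.GapDial.Automaton (blockDiag blockDiag_left blockDiag_right
  mv_blockDiag bd_zero_left EE bxor_append)
open Summit.QuantumAdvantage.QuantumAdvantage.Theorems.FlatDial (clen length_encode_eq_clen clen_injective clen_lt_clen le_clen)
open Summit.QuantumAdvantage.QuantumAdvantage.Theses.AnfPresentation (RungANonuniform RungA LiftA AnfEquiv NearExactIsExact
  SignedExactSliceIsLift)
open CubicForm (bit)
open DerivativeWalsh (W)
open BuzetChailloux (bxor zeroVec)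

/-! ## §9 ★★★ THE HIDDEN-COUPLING PLANTING: `W = U_0` IS A THEOREM (the dial is DECIDED below `T`)

The transpose trick.  Take the tree's Maiorana–McFarland gadget `F_w(x′,x″) = ⟨x′, Q_w x″ ⊕ e_{a₀}⟩ ⊕ x″_{b₀}` (`Fw`, `Q_w = QQ w` the
LITERAL unitriangular matrix of the mod-3 automaton), couple through `L_w = Q_w ⊕ Q_wᵀ` (block-diagonal, literal, invertible) and put on
the other side the SWAPPED gadget `G_w(y′,y″) = 1 ⊕ y′_{b₀} ⊕ ⟨y′, Q_wᵀ y″⟩ ⊕ y″_{a₀}` (literal).  Summing over `x′` forces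
`Q_w x″ = Q_w y′ ⊕ e_{a₀}`, i.e. `x″ = y′ ⊕ s_w` with the HARD vector `s_w = Q_w⁻¹ e_{a₀}` (`= qv w 0`); the transpose makes the hard shift
enter the remaining phase only through `Q_w s_w = e_{a₀}` (easy), and everything cancels except `s_w(b₀) = [#₁w ≡ 0 (3)]`:
`Φ_{L_w}(F_w, G_w) = -(-1)^{s_w(b₀)}`, EXACT.  The code is a literal projection of `w`, `|ker L_w| = 1`, so Smolensky closes:
`HiddenCouplingRung` HOLDS, hence EVERY `U_d` holds and `CouplingLift ⟺ RungANonuniform` — the co-rank dial carries NO Forrelation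
content: its permissive end absorbs `⊕L`-work (the inverse of a literal unitriangular matrix), and the blocker `T` is exactly the
statement that this work cannot be shifted into the instance when `L = 𝟙`. -/

section Hidden

variable {m : ℕ}

/-- transpose of a Boolean matrix. -/
def trM {k : ℕ} (M : Fin k → Fin k → Bool) : Fin k → Fin k → Bool := fun a b => M b a

/-- `⟨x, Mᵀ y⟩ = ⟨M x, y⟩`. -/
theorem bd_mv_trM {k : ℕ} (M : Fin k → Fin k → Bool) (x y : Fin k → Bool) : bd x (mv (trM M) y) = bd (mv M x) y := by
  apply bit_injective
  rw [bit_bd, bit_bd]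
  simp only [mv, trM, bit_bd, mul_sum, sum_mul]
  rw [sum_comm]
  exact sum_congr rfl fun j _ => sum_congr rfl fun i _ => by ring

/-- CouplingDialHidden helper `mv_zeroVec` (decomp-qadv land package; see the module docstring). -/
theorem mv_zeroVec {k : ℕ} (M : Fin k → Fin k → Bool) : mv M zeroVec = zeroVec := funext fun a => bd_zeroVec_right (M a)

/-- `Q_w (π_w⁻¹ t) = t ⊕ e_{a₀}`. -/
theorem mv_QQ_qv (w : Fin m → Bool) (t : Fin (kk m) → Bool) : mv (QQ w) (qv w t) = bxor t (sgl a₀) := by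
  have h : pv w (qv w t) = t := (pv_eq_iff w (qv w t) t).mpr rfl
  rw [pv] at h
  have h2 := congrArg (fun v => bxor v (sgl a₀)) h
  simp only [Summit.QuantumAdvantage.QuantumAdvantage.Theorems.CubicForrelation.ExactPairsMaioranaMcFarland.dv_bxor_cancel_right] at h2
  exact h2

/-- `Q_w` is injective (unitriangular). -/
theorem mv_QQ_injective (w : Fin m → Bool) {u v : Fin (kk m) → Bool} (h : mv (QQ w) u = mv (QQ w) v) : u = v := by
  have hp : pv w u = pv w v := by rw [pv, pv, h]
  rw [(pv_eq_iff w u (pv w v)).mp hp]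
  exact ((pv_eq_iff w v (pv w v)).mp rfl).symm

/-- the hard vector `s_w = Q_w⁻¹ e_{a₀} = π_w⁻¹(0)` satisfies `Q_w s_w = e_{a₀}`. -/
theorem mv_QQ_sw (w : Fin m → Bool) : mv (QQ w) (qv w zeroVec) = sgl a₀ := by
  rw [mv_QQ_qv, BuzetChailloux.zeroVec_bxor]

/-- `π_w⁻¹(Q_w y′ ⊕ e_{a₀})`, i.e. the solution `x″` of `Q_w x″ ⊕ e_{a₀} = Q_w y′`, is `y′ ⊕ s_w`. -/
theorem qv_mv_QQ (w : Fin m → Bool) (y₁ : Fin (kk m) → Bool) : qv w (mv (QQ w) y₁) = bxor y₁ (qv w zeroVec) := by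
  apply mv_QQ_injective w
  rw [mv_QQ_qv, mv_bxor, mv_QQ_sw]

/-- ★ THE SWAPPED GADGET `G_w(y′,y″) = 1 ⊕ y′_{b₀} ⊕ ⟨y′, Q_wᵀ y″⟩ ⊕ y″_{a₀}` (a LITERAL table). -/
def Gsw (w : Fin m → Bool) : CubicForm (kk m + kk m) := blTable (kk m) true (sgl b₀) (trM (QQ w)) (sgl a₀)

/-- CouplingDialHidden helper `eval_Gsw` (decomp-qadv land package; see the module docstring). -/
theorem eval_Gsw (w : Fin m → Bool) (y₁ y₂ : Fin (kk m) → Bool) :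
    (Gsw w).eval (Fin.append y₁ y₂) = xor (xor (xor true (y₁ b₀)) (bd (mv (QQ w) y₁) y₂)) (y₂ a₀) := by
  rw [Gsw, eval_blTable, bd_sgl_left, bd_mv_trM, bd_sgl_left]

/-- ★ THE HIDDEN-COUPLING INSTANCE `(F_w, L_w = Q_w ⊕ Q_wᵀ, G_w)` on `6m+6` variables. -/
def hinst (w : Fin m → Bool) : CTriple := ⟨kk m + kk m, Fw w, Gsw w, blockDiag (QQ w) (trM (QQ w))⟩

/-- the pointwise core of the coupled sum: after the `x`-sum (a Walsh transform of `F_w`), every `(y′,y″)` contributes `-2^k (-1)^{s_w(b₀)}`. -/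
theorem core_hinst (w : Fin m → Bool) (y₁ y₂ : Fin (kk m) → Bool) :
    2 ^ kk m * (signOf (qv w (mv (QQ w) y₁) b₀) * twist (qv w (mv (QQ w) y₁)) (mv (trM (QQ w)) y₂)) *
        signOf ((Gsw w).eval (Fin.append y₁ y₂))
      = -(2 : ℝ) ^ kk m * signOf (qv w zeroVec b₀) := by
  rw [qv_mv_QQ, ← signOf_bd, bd_mv_trM, mv_bxor, mv_QQ_sw, Summit.QuantumAdvantage.QuantumAdvantage.Theorems.FlatDial.bd_bxor_left, bd_sgl_left, eval_Gsw,
    show bxor y₁ (qv w zeroVec) b₀ = xor (y₁ b₀) (qv w zeroVec b₀) from rfl]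
  cases y₁ b₀ <;> cases y₂ a₀ <;> cases bd (mv (QQ w) y₁) y₂ <;> cases qv w zeroVec b₀ <;> norm_num

/-- ★ THE COUPLED SUM of the hidden-coupling instance: `S = -2^{k}·2^{2k}·(-1)^{s_w(b₀)}` (`k = 3m+3`). -/
theorem csum_hinst (w : Fin m → Bool) :
    ∑ x : Fin (kk m + kk m) → Bool, ∑ y : Fin (kk m + kk m) → Bool,
        signOf ((Fw w).eval x) * twist x (mv (blockDiag (QQ w) (trM (QQ w))) y) * signOf ((Gsw w).eval y)
      = -((2 : ℝ) ^ kk m * 2 ^ (kk m + kk m)) * signOf (qv w zeroVec b₀) := by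
  rw [sum_comm]
  simp_rw [← sum_mul]
  rw [sum_append]
  simp_rw [mv_blockDiag]
  have hW : ∀ y₁ y₂ : Fin (kk m) → Bool,
      ∑ x : Fin (kk m + kk m) → Bool, signOf ((Fw w).eval x) * twist x (Fin.append (mv (QQ w) y₁) (mv (trM (QQ w)) y₂))
        = 2 ^ kk m * (signOf (qv w (mv (QQ w) y₁) b₀) * twist (qv w (mv (QQ w) y₁)) (mv (trM (QQ w)) y₂)) :=
    fun y₁ y₂ => W_Fw w (mv (QQ w) y₁) (mv (trM (QQ w)) y₂)
  rw [show (∑ y₁ : Fin (kk m) → Bool, ∑ y₂ : Fin (kk m) → Bool,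
      (∑ x : Fin (kk m + kk m) → Bool, signOf ((Fw w).eval x) * twist x (Fin.append (mv (QQ w) y₁) (mv (trM (QQ w)) y₂))) *
        signOf ((Gsw w).eval (Fin.append y₁ y₂)))
      = ∑ y₁ : Fin (kk m) → Bool, ∑ y₂ : Fin (kk m) → Bool, -(2 : ℝ) ^ kk m * signOf (qv w zeroVec b₀) from
    sum_congr rfl fun y₁ _ => sum_congr rfl fun y₂ _ => by rw [hW]; exact core_hinst w y₁ y₂]
  simp only [sum_const, card_univ, Fintype.card_fun, Fintype.card_bool, Fintype.card_fin, nsmul_eq_mul, Nat.cast_pow,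
    Nat.cast_ofNat]
  ring

/-- ★★ EXACTNESS + LABEL: `Φ_{L_w}(F_w, G_w) = -(-1)^{s_w(b₀)}`, modulus exactly `1`, sign = `MOD₃(w)`. -/
theorem cvalue_hinst (w : Fin m → Bool) : (hinst w).cvalue = - signOf (qv w zeroVec b₀) := by
  show (Real.sqrt (2 ^ (3 * (kk m + kk m))))⁻¹ *
    ∑ x : Fin (kk m + kk m) → Bool, ∑ y : Fin (kk m + kk m) → Bool,
        signOf ((Fw w).eval x) * twist x (mv (blockDiag (QQ w) (trM (QQ w))) y) * signOf ((Gsw w).eval y) = _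
  rw [csum_hinst]
  have h3 : Real.sqrt ((2 : ℝ) ^ (3 * (kk m + kk m))) = 2 ^ kk m * 2 ^ (kk m + kk m) := by
    rw [show 3 * (kk m + kk m) = 3 * kk m + 3 * kk m by ring, SgnForrMem.sqrt_two_pow_add_self, ← pow_add,
      show kk m + (kk m + kk m) = 3 * kk m by ring]
  rw [h3]
  have h5 : (2 : ℝ) ^ kk m * 2 ^ (kk m + kk m) ≠ 0 := by positivity
  field_simp

/-- ★★ THE COUPLING IS INVERTIBLE: `ker (Q_w ⊕ Q_wᵀ) = 0`. -/
theorem kerCard_hinst (w : Fin m → Bool) : (hinst w).kerCard ≤ 1 := by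
  have key : ∀ y : Fin (kk m + kk m) → Bool, mv (hinst w).L y = zeroVec → y = zeroVec := by
    intro y hy
    obtain ⟨⟨y₁, y₂⟩, rfl⟩ := (Fin.appendEquiv _ _).surjective y
    have h2 : mv (blockDiag (QQ w) (trM (QQ w))) (Fin.append y₁ y₂) = zeroVec := hy
    rw [mv_blockDiag] at h2
    have hA : mv (QQ w) y₁ = zeroVec := by
      funext a; have := congr_fun h2 (Fin.castAdd (kk m) a); rwa [Fin.append_left] at this
    have hB : mv (trM (QQ w)) y₂ = zeroVec := by
      funext b; have := congr_fun h2 (Fin.natAdd (kk m) b); rwa [Fin.append_right] at this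
    have h1 : y₁ = zeroVec := mv_QQ_injective w (by rw [hA, mv_zeroVec])
    have h2' : y₂ = zeroVec := by
      funext i
      have hu : mv (QQ w) (qv w (bxor (sgl i) (sgl a₀))) = sgl i := by
        rw [mv_QQ_qv, Summit.QuantumAdvantage.QuantumAdvantage.Theorems.CubicForrelation.ExactPairsMaioranaMcFarland.dv_bxor_cancel_right]
      have := bd_mv_trM (QQ w) (qv w (bxor (sgl i) (sgl a₀))) y₂
      rw [hB, bd_zeroVec_right, hu, bd_sgl_left] at this
      exact this.symm
    show Fin.append y₁ y₂ = zeroVec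
    rw [h1, h2']
    funext i
    refine Fin.addCases (fun a => ?_) (fun b => ?_) i
    · rw [Fin.append_left]; rfl
    · rw [Fin.append_right]; rfl
  exact Fintype.card_le_one_iff_subsingleton.mpr
    ⟨fun a b => Subtype.ext ((key a.1 a.2).trans (key b.1 b.2).symm)⟩

/-- CouplingDialHidden helper `isLit_Gsw_cube` (decomp-qadv land package; see the module docstring). -/
theorem isLit_Gsw_cube (i j l : Fin (kk m + kk m)) : IsLit fun w : Fin m → Bool => (Gsw w).cube i j l := by
  unfold Gsw blTable
  refine IsLit.const_and _ ?_
  generalize finSumFinEquiv.symm i = u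
  generalize finSumFinEquiv.symm l = v
  rcases u with a | b <;> rcases v with a' | b'
  · exact IsLit.const _
  · exact isLit_qEnt _ _
  · exact IsLit.const _
  · exact IsLit.const _

/-- CouplingDialHidden helper `isLit_L_hinst` (decomp-qadv land package; see the module docstring). -/
theorem isLit_L_hinst (a b : Fin (kk m + kk m)) : IsLit fun w : Fin m → Bool => blockDiag (QQ w) (trM (QQ w)) a b := by
  refine Fin.addCases (fun a₁ => ?_) (fun a₂ => ?_) a
  · simp_rw [blockDiag_left]
    refine Fin.addCases (fun b₁ => ?_) (fun b₂ => ?_) b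
    · simp_rw [Fin.append_left]; exact isLit_qEnt _ _
    · simp_rw [Fin.append_right]; exact IsLit.const _
  · simp_rw [blockDiag_right]
    refine Fin.addCases (fun b₁ => ?_) (fun b₂ => ?_) b
    · simp_rw [Fin.append_left]; exact IsLit.const _
    · simp_rw [Fin.append_right]; exact isLit_qEnt _ _

/-- ★ `w ↦ code(hinst w)` IS A LITERAL PROJECTION (matrix bits, `F_w`, `G_w` all literal; arity constant in `w`). -/
theorem isProj_encode_hinst : IsProj fun w : Fin m → Bool => (hinst w).encode := by
  show IsProj fun w : Fin m → Bool => boolPair (CTriple.matBits (blockDiag (QQ w) (trM (QQ w))))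
    (boolPair (encodeNat (kk m + kk m)) (boolPair (Fw w).encode (Gsw w).encode))
  refine (IsProj.ofFn _ fun q => IsProj.single (isLit_L_hinst _ _)).boolPair ((IsProj.const _).boolPair
    ((isProj_encode_form Fw false (fun _ => rfl) isLit_Fw_cube).boolPair
      (isProj_encode_form Gsw true (fun _ => rfl) isLit_Gsw_cube)))

/-- CouplingDialHidden helper `length_encode_hinst_le` (decomp-qadv land package; see the module docstring). -/
theorem length_encode_hinst_le (w : Fin m → Bool) : (hinst w).encode.length ≤ (tPoly.comp (nPoly 0)).eval m := by
  rw [Polynomial.eval_comp]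
  refine (length_encode_le_tPoly _).trans (natPoly_eval_mono tPoly ?_)
  show kk m + kk m ≤ _
  simp only [nPoly, kk, Polynomial.eval_add, Polynomial.eval_mul, Polynomial.eval_X, Polynomial.eval_ofNat,
    Polynomial.eval_zero]
  omega

/-- CouplingDialHidden helper `hinst_mem_yes` (decomp-qadv land package; see the module docstring). -/
theorem hinst_mem_yes (w : Fin m → Bool) (h3 : GateFn.numOnes w % 3 = 0) : (hinst w).encode ∈ (CoupledSlice fun _ => 0).yes := by
  refine ⟨hinst w, ⟨⟨kk m, rfl⟩, (kerCard_hinst w).trans (by norm_num), ?_⟩, rfl⟩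
  rw [cvalue_hinst, qv_zeroVec_b₀, decide_eq_true h3]; norm_num [signOf]

/-- CouplingDialHidden helper `hinst_mem_no` (decomp-qadv land package; see the module docstring). -/
theorem hinst_mem_no (w : Fin m → Bool) (h3 : ¬ GateFn.numOnes w % 3 = 0) : (hinst w).encode ∈ (CoupledSlice fun _ => 0).no := by
  refine ⟨hinst w, ⟨⟨kk m, rfl⟩, (kerCard_hinst w).trans (by norm_num), ?_⟩, rfl⟩
  rw [cvalue_hinst, qv_zeroVec_b₀, decide_eq_false h3]; norm_num [signOf]

/-- ★★★ `W = U_0` IS A THEOREM: the hidden-invertible-coupling exact signed cubic slice is NOT in promise-`AC⁰[⊕]` (Smolensky via the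
transpose planting).  Consequently the whole co-rank dial is decided and the residual `CouplingLift` IS the target. -/
theorem hiddenCouplingRung : HiddenCouplingRung :=
  not_promiseLift_AC0Mod_of_proj Nat.prime_two Nat.prime_three (by decide) _ (fun m w => (hinst w).encode)
    (fun m => isProj_encode_hinst) (tPoly.comp (nPoly 0)) (fun m w => length_encode_hinst_le w)
    (fun m w h => hinst_mem_yes w h) (fun m w h => hinst_mem_no w h)

/-- every co-rank budget is a THEOREM. -/
theorem couplingRung_all (d : ℕ → ℕ) : CouplingRung d := couplingRung_of_hidden d hiddenCouplingRung

/-- CouplingDialHidden helper `logCouplingRung` (decomp-qadv land package; see the module docstring). -/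
theorem logCouplingRung : LogCouplingRung := couplingRung_all _

/-- CouplingDialHidden helper `constCouplingRung` (decomp-qadv land package; see the module docstring). -/
theorem constCouplingRung (c : ℕ) : ConstCouplingRung c := couplingRung_all _

/-- ★★ THE DIAL COLLAPSES ONTO ITS RESIDUAL: `CouplingLift ⟺ RungANonuniform` (the blocker is exactly the `L⁻¹`-lift). -/
theorem couplingLift_iff_rungANonuniform : CouplingLift ↔ RungANonuniform :=
  ⟨fun ℓ => ℓ hiddenCouplingRung, fun h _ => h⟩

/-- `closes` with the proved piece discharged. -/
theorem closes' (h₁ : NearExactIsExact) (h₂ : SignedExactSliceIsLift) (ℓ : CouplingLift) (p₂ : LiftA) (hE : AnfEquiv) :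
    QuantumAdvantage :=
  closes h₁ h₂ hiddenCouplingRung ℓ p₂ hE

end Hidden

end Summit.QuantumAdvantage.QuantumAdvantage.Theorems.CouplingDial

end
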